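import Literature.Geometry.Manifold.TranslationFlow
import Literature.Geometry.Manifold.SubmersionLift
import Literature.Geometry.Manifold.CompactSupportFlow
import Mathlib.Geometry.Manifold.PartitionOfUnity
import Mathlib.Geometry.Manifold.VectorBundle.ContMDiffSection
import Literature.AlgebraicGeometry.Motives.ComplexPointsSubmersion
import Literature.Geometry.Manifold.OpenSubmanifoldMFDeriv
import Literature.AlgebraicGeometry.HodgeTheory.HodgeLocus

/-!
# Route LimitExtension — `SpecialisationOfAlgebraicity` (item stmt-HodgeConjecture-2998): moving compacta off a special fibre

Helpers for the `limit` half of the support item `SpecialisationOfAlgebraicity` (supports can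
only grow when a class is specialised into the SMOOTH locus of a degenerating family; see
`specialisationOfAlgebraicity_of_spread_of_limit` in
`Theorems/LimitExtensionSpecialisationOfAlgebraicity.lean`). Near the smooth open piece of the
special fibre the family is a submersion on complex points but is NOT proper, so Ehresmann's
theorem is replaced by its local form:

* `exists_continuous_motion_translate_of_isCompact` — general differential topology: for a `C^∞`
  map `g : N → F` with onto differential on a Hausdorff second-countable manifold, `c : F` and a
  COMPACT `K ⊆ N`, the flow `Θ` of a compactly supported cut-off of a lift of the constant field `c`
  (Bröcker–Jänich 1982, proof of (8.12); Lee 2012, Thm. 9.16) is a global continuous motion with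
  `Θ (0, x) = x` which translates `g` near `K` for small times: `g (Θ (t, x)) = g x + t • c`,
  `x ∈ K`, `|t| < ε`. No properness is needed.
* `exists_motion_off_fibre` — on the tree's real carriers: for a smooth morphism `fM : M ⟶ T` of
  smooth `ℂ`-schemes (`T` a curve), `t₀ ∈ T(ℂ)`, a closed `C ⊆ M(ℂ)` and a compact family
  `e : Kt → M(ℂ)` of points of the fibre over `t₀` avoiding `C`, there are `t₁ ≠ t₀` and a continuous
  `Γ : ℝ × Kt → M(ℂ)` from `e` (time `0`) to a family of points of the fibre over `t₁` avoiding `C`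
  (time `1`) — the input of "vanishing is detected on compacta up to homotopy"
  (`HodgeTheory.singularCohomology_map_eq_zero_of_compact_homotopy`).
-/

noncomputable section

open scoped Manifold ContDiff Topology
open Set Function Filter

-- `Summit.HodgeConjecture.HodgeConjecture.Theorems` is the mandated namespace (single-conjunct summit:
-- Sub = Summit), which `linter.dupNamespace` flags on every declaration; the lakefile turns the
-- linter off tree-wide (weak option), restated here so stand-alone elaboration is warning-free too.
set_option linter.dupNamespace false

namespace Summit.HodgeConjecture.HodgeConjecture.Theorems

universe u v

variable {EN : Type u} [NormedAddCommGroup EN] [NormedSpace ℝ EN] [FiniteDimensional ℝ EN]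
  {H : Type v} [TopologicalSpace H] {I : ModelWithCorners ℝ EN H} [I.Boundaryless]
  {N : Type*} [TopologicalSpace N] [ChartedSpace H N] [IsManifold I ∞ N] [T2Space N]
  [SecondCountableTopology N]
  {F : Type*} [NormedAddCommGroup F] [NormedSpace ℝ F] [FiniteDimensional ℝ F]
  {g : N → F}

/-- **Local Ehresmann: compact pieces move into the nearby fibres of a submersion.** Let
`g : N → F` be `C^∞` with onto differential everywhere, on a Hausdorff second-countable `C^∞`
manifold without boundary over a finite-dimensional real model, `c : F`, and `K ⊆ N` compact. Then
there are a continuous `Θ : ℝ × N → N` with `Θ (0, x) = x` and an `ε > 0` such that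
`g (Θ (t, x)) = g x + t • c` for all `x ∈ K` and `|t| < ε`. Proof: lift `c` to a `C^∞` field `X`
with `dg(X) = c` (Bröcker–Jänich, proof of (8.12)); cut it off by a smooth `χ`, `χ = 1` on an open
`O ⊇ K`, `χ = 0` off a compact `L` (partition of unity); the field `χ • X` is complete (Lee, Thm.
9.16) with global flow `Θ`; by the tube lemma the flow lines from `K` stay inside `O` for `|t| < ε`,
where they are integral curves of `X`, along which `g` is translated by `c`.
[cite: BrockerJanichIDT1982, (8.12) (proof)] [cite: LeeSmoothManifolds2013, Thm. 9.16] -/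
theorem exists_continuous_motion_translate_of_isCompact
    (hg : ContMDiff I 𝓘(ℝ, F) ∞ g) (hsurj : ∀ x, Surjective (mfderiv I 𝓘(ℝ, F) g x)) (c : F)
    {K : Set N} (hK : IsCompact K) :
    ∃ Θ : ℝ × N → N, Continuous Θ ∧ (∀ x, Θ (0, x) = x) ∧
      ∃ ε > (0 : ℝ), ∀ x ∈ K, ∀ t : ℝ, |t| < ε → g (Θ (t, x)) = g x + t • c := by
  haveI : LocallyCompactSpace N := Manifold.locallyCompact_of_finiteDimensional (M := N) I
  -- a global lift `X` of the constant field `c`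
  obtain ⟨X, hX, hXc⟩ :=
    Literature.Geometry.Manifold.exists_contMDiff_lift_of_surjective_mfderiv hg hsurj c
  -- a compact `L` with `K ⊆ interior L`, an open `O` with `K ⊆ O`, `closure O ⊆ interior L`
  obtain ⟨L, hL, hKL⟩ := exists_compact_superset hK
  obtain ⟨O, hOo, hKO, hOL, -⟩ :=
    exists_open_between_and_isCompact_closure hK isOpen_interior hKL
  -- a smooth cut-off `χ`, `= 0` off `interior L`, `= 1` on `closure O`
  obtain ⟨χ, hχ0, hχ1, -⟩ := exists_contMDiffMap_zero_one_of_isClosed (I := I) (n := ⊤)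
    isOpen_interior.isClosed_compl isClosed_closure
    (disjoint_compl_left_iff_subset.mpr hOL)
  -- the cut-off field `Y = χ • X` vanishes off the compact `L`
  set Y : Π x : N, TangentSpace I x := fun x => (χ x) • X x with hYdef
  have hY : ContMDiff I I.tangent ∞ (fun x => (⟨x, Y x⟩ : TangentBundle I N)) :=
    ContMDiff.smul_section (I := I) (F := EN) (V := TangentSpace I) χ.contMDiff hX
  have hYL : ∀ x, x ∉ L → Y x = 0 := fun x hx => by
    have hx' : x ∈ (interior L)ᶜ := fun h => hx (interior_subset h)
    simp only [hYdef, hχ0 hx', Pi.zero_apply, zero_smul]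
  -- its global flow
  obtain ⟨Θ, hΘ, hΘ0, -, hΘint, -⟩ :=
    Literature.Geometry.Manifold.exists_contMDiff_globalFlow_of_eq_zero_off_isCompact
      (I := I) (n := ⊤) hY le_top hL hYL
  refine ⟨Θ, hΘ.continuous, hΘ0, ?_⟩
  -- tube lemma: flow lines from `K` stay in `O` for small times
  have hΩ : IsOpen {q : ℝ × N | Θ q ∈ O} := hOo.preimage hΘ.continuous
  have hΩ0 : ({(0 : ℝ)} : Set ℝ) ×ˢ K ⊆ {q : ℝ × N | Θ q ∈ O} := by
    rintro ⟨t, x⟩ ⟨ht, hx⟩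
    rw [mem_singleton_iff] at ht
    subst ht
    change Θ (0, x) ∈ O
    rw [hΘ0]
    exact hKO hx
  obtain ⟨J, U, hJ, -, hJ0, hKU, hJU⟩ := generalized_tube_lemma isCompact_singleton hK hΩ hΩ0
  obtain ⟨ε, hε, hεJ⟩ := Metric.isOpen_iff.mp hJ 0 (hJ0 (mem_singleton 0))
  refine ⟨ε, hε, fun x hx t ht => ?_⟩
  -- the flow line through `x ∈ K` is an integral curve of `X` on `(-ε, ε)`
  have hmemO : ∀ s ∈ Ioo (-ε) ε, Θ (s, x) ∈ O := fun s hs => by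
    have hsJ : s ∈ J := hεJ (by simpa [Real.ball_eq_Ioo] using hs)
    exact hJU (mk_mem_prod hsJ (hKU hx))
  have hγY : IsMIntegralCurveOn (fun s => Θ (s, x)) Y (Ioo (-ε) ε) :=
    (hΘint x).isMIntegralCurveOn _
  have hγX : IsMIntegralCurveOn (fun s => Θ (s, x)) X (Ioo (-ε) ε) := fun s hs => by
    have h := hγY s hs
    have hYX : Y (Θ (s, x)) = X (Θ (s, x)) := by
      simp only [hYdef, hχ1 (subset_closure (hmemO s hs)), Pi.one_apply, one_smul]
    rwa [hYX] at h
  have h := Literature.Geometry.Manifold.apply_integralCurve_eq_add_smul (hg.of_le (by simp)) hXc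
    isOpen_Ioo (ordConnected_Ioo) hγX (t₀ := 0) (t := t) (by simpa using hε)
    (by simpa [abs_lt] using ht)
  simpa [hΘ0] using h

/-! ### Moving compacta of complex points off a fibre of a smooth morphism -/

section ComplexPoints

open CategoryTheory AlgebraicGeometry
open Literature.AlgebraicGeometry.Motives

/-- **Compact families of complex points in a fibre of a smooth morphism move into the nearby
fibres, avoiding a closed set.** Let `fM : M ⟶ T` be a smooth morphism of `ℂ`-schemes, `M` smooth
of relative dimension `d` and separated over `ℂ` with second countable complex points, `T` smooth
of relative dimension `1` (both locally of finite type), `t₀ ∈ T(ℂ)`, `C ⊆ M(ℂ)` closed, and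
`e : Kt → M(ℂ)` a continuous map from a compact space into the fibre over `t₀` avoiding `C`. Then
there are `t₁ ≠ t₀` in `T(ℂ)` and a continuous `Γ : ℝ × Kt → M(ℂ)` with `Γ (0, κ) = e κ` and
`Γ (1, κ)` in the fibre over `t₁` and off `C` — the motion by the flow of a cut-off lift of a
coordinate field of `T(ℂ)` at `t₀` (`exists_continuous_motion_translate_of_isCompact`, applied on the
open submanifold of `M(ℂ)` over a chart of `T(ℂ)`, where `fM(ℂ)` followed by the chart is a
submersion: `Motives.ComplexPoints.surjective_mfderiv_map`, SGA1 XII Prop. 3.1 (iv)).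
[cite: BrockerJanichIDT1982, (8.12) (proof)] [cite: SGA1, Exp. XII Prop. 3.1 (iv)] -/
theorem exists_motion_off_fibre {d : ℕ} {M T : SchemeOver ℂ} [LocallyOfFiniteType M.hom]
    [SmoothOfRelativeDimension d M.hom] [IsSeparated M.hom]
    [SecondCountableTopology (ComplexPoints M)]
    [LocallyOfFiniteType T.hom] [SmoothOfRelativeDimension 1 T.hom]
    (fM : M ⟶ T) [Smooth fM.left] (t₀ : ComplexPoints T) {C : Set (ComplexPoints M)}
    (hC : IsClosed C) {Kt : Type} [TopologicalSpace Kt] [CompactSpace Kt]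
    (e : C(Kt, ComplexPoints M)) (he : ∀ κ, AlgPoints.map fM (e κ) = t₀) (heC : ∀ κ, e κ ∉ C) :
    ∃ t₁ : ComplexPoints T, t₁ ≠ t₀ ∧ ∃ Γ : C(ℝ × Kt, ComplexPoints M),
      (∀ κ, Γ (0, κ) = e κ) ∧ (∀ κ, AlgPoints.map fM (Γ (1, κ)) = t₁) ∧ ∀ κ, Γ (1, κ) ∉ C := by
  letI := ComplexPoints.chartedSpace M d
  letI := ComplexPoints.chartedSpace T 1
  haveI := ComplexPoints.isManifold_real M d
  haveI := ComplexPoints.isManifold_real T 1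
  haveI : T2Space (ComplexPoints M) := ComplexPoints.t2Space_of_isSeparated M
  set F := (AlgPoints.map fM : ComplexPoints M → ComplexPoints T) with hFdef
  have hF : ContMDiff (𝓡 (2 * d)) (𝓡 (2 * 1)) ∞ F := ComplexPoints.contMDiff_map fM
  have hFsurj : ∀ P, Surjective (mfderiv (𝓡 (2 * d)) (𝓡 (2 * 1)) F P) :=
    ComplexPoints.surjective_mfderiv_map fM
  -- the chart of `T(ℂ)` at `t₀` and the open submanifold of `M(ℂ)` over its source
  set ψ := extChartAt (𝓡 (2 * 1)) t₀ with hψ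
  set O : TopologicalSpace.Opens (ComplexPoints M) :=
    ⟨F ⁻¹' (chartAt (EuclideanSpace ℝ (Fin (2 * 1))) t₀).source,
      (chartAt _ t₀).open_source.preimage hF.continuous⟩ with hO
  have hOmem : ∀ x : O, F x.1 ∈ (chartAt (EuclideanSpace ℝ (Fin (2 * 1))) t₀).source := fun x => x.2
  have hOmem' : ∀ x : O, F x.1 ∈ ψ.source := fun x => by
    rw [hψ, extChartAt_source]; exact x.2
  -- `g = ψ ∘ F` on `O` is smooth with onto differential
  set g : O → EuclideanSpace ℝ (Fin (2 * 1)) := fun x => ψ (F x.1) with hg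
  have hgs : ContMDiff (𝓡 (2 * d)) 𝓘(ℝ, EuclideanSpace ℝ (Fin (2 * 1))) ∞ g :=
    (contMDiffOn_extChartAt (x := t₀)).comp_contMDiff (hF.comp contMDiff_subtype_val)
      fun x => hOmem x
  have hgsurj : ∀ x : O, Surjective (mfderiv (𝓡 (2 * d)) 𝓘(ℝ, EuclideanSpace ℝ (Fin (2 * 1))) g x) := by
    intro x
    have h0 : HasMFDerivAt (𝓡 (2 * d)) (𝓡 (2 * d)) (Subtype.val : O → ComplexPoints M) x
        (ContinuousLinearMap.id ℝ _) :=
      Literature.Geometry.Manifold.OpenSubmanifold.hasMFDerivAt_subtype_val x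
    have h1 : HasMFDerivAt (𝓡 (2 * d)) (𝓡 (2 * 1)) F x.1 (mfderiv (𝓡 (2 * d)) (𝓡 (2 * 1)) F x.1) :=
      (hF.mdifferentiableAt (by simp)).hasMFDerivAt
    have h2 : HasMFDerivAt (𝓡 (2 * 1)) 𝓘(ℝ, EuclideanSpace ℝ (Fin (2 * 1))) ψ (F x.1)
        (mfderiv (𝓡 (2 * 1)) 𝓘(ℝ, EuclideanSpace ℝ (Fin (2 * 1))) ψ (F x.1)) :=
      (mdifferentiableAt_extChartAt (hOmem x)).hasMFDerivAt
    have hchain := h2.comp x (h1.comp x h0)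
    have heq : mfderiv (𝓡 (2 * d)) 𝓘(ℝ, EuclideanSpace ℝ (Fin (2 * 1))) g x =
        (mfderiv (𝓡 (2 * 1)) 𝓘(ℝ, EuclideanSpace ℝ (Fin (2 * 1))) ψ (F x.1)).comp
          ((mfderiv (𝓡 (2 * d)) (𝓡 (2 * 1)) F x.1).comp (ContinuousLinearMap.id ℝ _)) :=
      hchain.mfderiv
    have hψs : Surjective (mfderiv (𝓡 (2 * 1)) 𝓘(ℝ, EuclideanSpace ℝ (Fin (2 * 1))) ψ (F x.1)) := by
      obtain ⟨L, hL⟩ : (mfderiv (𝓡 (2 * 1)) 𝓘(ℝ, EuclideanSpace ℝ (Fin (2 * 1))) ψ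
          (F x.1)).IsInvertible := isInvertible_mfderiv_extChartAt (hOmem' x)
      rw [← hL]; exact L.surjective
    rw [heq]
    intro w
    obtain ⟨v₂, hv₂⟩ := hψs w
    obtain ⟨v₃, hv₃⟩ := hFsurj x.1 v₂
    refine ⟨v₃, ?_⟩
    rw [← hv₂, ← hv₃]
    rfl
  -- lift `e` into `O` and move its compact image
  have heO : ∀ κ, e κ ∈ O := fun κ => by
    change F (e κ) ∈ (chartAt (EuclideanSpace ℝ (Fin (2 * 1))) t₀).source
    rw [show F (e κ) = t₀ from he κ]
    exact mem_chart_source _ t₀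
  set eO : C(Kt, O) := ⟨fun κ => ⟨e κ, heO κ⟩, e.continuous.subtype_mk _⟩ with heOdef
  set c : EuclideanSpace ℝ (Fin (2 * 1)) := EuclideanSpace.single 0 1 with hc
  have hc0 : c ≠ 0 := fun h => by
    have := congrArg (fun v : EuclideanSpace ℝ (Fin (2 * 1)) => v 0) h
    simp [hc] at this
  obtain ⟨Θ, hΘ, hΘ0, ε, hε, htr⟩ := exists_continuous_motion_translate_of_isCompact
    (I := 𝓡 (2 * d)) hgs hgsurj c (isCompact_range eO.continuous)
  -- small times: stay off `C` (tube lemma) and inside the chart target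
  have hgood : IsOpen {q : ℝ × Kt | (Θ (q.1, eO q.2)).1 ∉ C} := by
    have hcont : Continuous fun q : ℝ × Kt => (Θ (q.1, eO q.2)).1 :=
      continuous_subtype_val.comp (hΘ.comp (continuous_fst.prodMk (eO.continuous.comp continuous_snd)))
    exact hC.isOpen_compl.preimage hcont
  have hgood0 : ({(0 : ℝ)} : Set ℝ) ×ˢ (univ : Set Kt) ⊆ {q : ℝ × Kt | (Θ (q.1, eO q.2)).1 ∉ C} := by
    rintro ⟨s, κ⟩ ⟨hs, -⟩
    rw [mem_singleton_iff] at hs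
    subst hs
    change (Θ (0, eO κ)).1 ∉ C
    rw [hΘ0]
    exact heC κ
  obtain ⟨J, U', hJ, -, hJ0, hU', hJU'⟩ :=
    generalized_tube_lemma isCompact_singleton isCompact_univ hgood hgood0
  obtain ⟨δ, hδ, hδJ⟩ := Metric.isOpen_iff.mp hJ 0 (hJ0 (mem_singleton 0))
  obtain ⟨δ', hδ', hδ'T⟩ := Metric.isOpen_iff.mp (isOpen_extChartAt_target (I := 𝓡 (2 * 1)) t₀)
    (ψ t₀) (mem_extChartAt_target t₀)
  -- the time `τ`
  set τ : ℝ := min (min ε δ) δ' / 2 with hτ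
  have hτpos : 0 < τ := by positivity
  have hτε : |τ| < ε := by
    rw [abs_of_pos hτpos, hτ]
    have : min (min ε δ) δ' ≤ ε := (min_le_left _ _).trans (min_le_left _ _)
    linarith
  have hτδ : τ ∈ J := hδJ (by
    rw [Metric.mem_ball, dist_zero_right, Real.norm_eq_abs, abs_of_pos hτpos, hτ]
    have : min (min ε δ) δ' ≤ δ := (min_le_left _ _).trans (min_le_right _ _)
    linarith)
  have hτδ' : ψ t₀ + τ • c ∈ ψ.target := hδ'T (by
    rw [Metric.mem_ball, dist_eq_norm, add_sub_cancel_left, norm_smul, Real.norm_eq_abs,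
      abs_of_pos hτpos]
    have hc1 : ‖c‖ = 1 := by simp [hc]
    rw [hc1, mul_one, hτ]
    have : min (min ε δ) δ' ≤ δ' := min_le_right _ _
    linarith)
  -- the nearby point `t₁`
  set t₁ : ComplexPoints T := ψ.symm (ψ t₀ + τ • c) with ht₁
  have hψt₁ : ψ t₁ = ψ t₀ + τ • c := ψ.right_inv hτδ'
  refine ⟨t₁, fun h => hc0 ?_, ?_⟩
  · have h1 : τ • c = 0 := by
      have := hψt₁
      rw [h] at this
      exact (add_eq_left.mp this.symm)
    exact (smul_eq_zero.mp h1).resolve_left hτpos.ne'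
  -- the motion
  refine ⟨⟨fun q => (Θ (q.1 * τ, eO q.2)).1, continuous_subtype_val.comp
      (hΘ.comp ((continuous_fst.mul continuous_const).prodMk (eO.continuous.comp continuous_snd)))⟩,
    fun κ => ?_, fun κ => ?_, fun κ => ?_⟩
  · change (Θ (0 * τ, eO κ)).1 = e κ
    rw [zero_mul, hΘ0, heOdef]
    rfl
  · change F (Θ (1 * τ, eO κ)).1 = t₁
    rw [one_mul]
    have hg1 : g (Θ (τ, eO κ)) = ψ t₀ + τ • c := by
      rw [htr _ (mem_range_self κ) τ hτε]
      change ψ (F (e κ)) + τ • c = _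
      rw [show F (e κ) = t₀ from he κ]
    have hsrc : F (Θ (τ, eO κ)).1 ∈ ψ.source := hOmem' _
    calc F (Θ (τ, eO κ)).1 = ψ.symm (ψ (F (Θ (τ, eO κ)).1)) := (ψ.left_inv hsrc).symm
      _ = t₁ := by rw [show ψ (F (Θ (τ, eO κ)).1) = g (Θ (τ, eO κ)) from rfl, hg1]
  · change (Θ (1 * τ, eO κ)).1 ∉ C
    rw [one_mul]
    exact hJU' (mk_mem_prod hτδ (hU' (mem_univ κ)))

end ComplexPoints

end Summit.HodgeConjecture.HodgeConjecture.Theorems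

end
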